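import Mathlib
import HarnessLib

/-!
# Rational descent of linear relations: a complex solution of a rational linear system yields a rational one
(route `ManinLocalTwoThree`, crux C3 `ManinPrimeToThreeAtNine` stmt-BirchSwinnertonDyer-22968; cell bsd-f2-manin, C3 LEAD p1 gen 15;
`--supports stmt-BirchSwinnertonDyer-22968`; Mathlib only)

Use in the C3 modular-form witness (p2 g17 DESIGN NOTE 2026-08-29T15:35Z, LEAD decision 15:5xZ): the local representation theorem
`ModularCurveLocalRingsAtPoints.exists_mul_aeval_eq_aeval` presents the weight-0 function `t_s` as `t_s · q(v) = p(v)` with COMPLEX polynomials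
`p, q` in the eight coordinate functions `v` of `X₀(N)`; since `t_s` and the `vᵢ` have RATIONAL `q`-expansions, the relation is a system of
ℚ-linear equations (one per power of `q`) in the finitely many coefficients of `(q, p)`, and «some coefficient of `q(v)` is nonzero» is a
ℚ-linear functional.  The lemma below then produces RATIONAL `(q̃, p̃)` with the same two properties — so the multiplier `B = q̃(v)Δ^m` of the
witness has a rational `q`-expansion WITHOUT the descent `ℂ(X₀(N))^{Aut ℂ} = ℚ(X₀(N))` (Shimura 1971 Prop. 6.9), which is not in the tree.

* `exists_rat_coords` — every `x : ι → ℂ` (ι finite) is `xᵢ = Σₖ (cᵢₖ : ℂ)·eₖ` with `cᵢₖ ∈ ℚ` and `(eₖ)` ℚ-linearly independent in `ℂ`;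
* `sum_ratCast_mul_eq_zero_iff` — for such a presentation, `Σᵢ (aᵢ : ℂ)·xᵢ = 0 ↔ ∀ k, Σᵢ aᵢ·cᵢₖ = 0` (`aᵢ ∈ ℚ`);
* **`exists_rat_of_complex_solution`** — the descent statement.

HONEST FRAMING.  Linear algebra only; nothing about C3, Manin's conjecture or BSD is proved here.  No definitions, no sorry. [folklore]
-/

set_option autoImplicit false
-- lint-debt: the directory name repeats the summit name (sibling precedent `ManinLocalTwoThreeUDCGlue.lean`)
set_option linter.dupNamespace false

noncomputable section

open scoped BigOperators

namespace Summit.BirchSwinnertonDyer.BirchSwinnertonDyer.Theorems.ManinLocalTwoThree.RationalDescent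

/-- **Rational coordinates.**  A finite family of complex numbers has rational coordinates with respect to a finite ℚ-linearly independent
family of complex numbers (a ℚ-basis of the ℚ-span). [folklore] -/
theorem exists_rat_coords {ι : Type*} [Fintype ι] (x : ι → ℂ) :
    ∃ (n : ℕ) (e : Fin n → ℂ) (c : ι → Fin n → ℚ), LinearIndependent ℚ e ∧ ∀ i, x i = ∑ k, (c i k : ℂ) * e k := by
  classical
  set E : Submodule ℚ ℂ := Submodule.span ℚ (Set.range x) with hE
  haveI : Module.Finite ℚ E := Module.Finite.span_of_finite ℚ (Set.finite_range x)
  let bE := Module.finBasis ℚ E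
  refine ⟨Module.finrank ℚ E, fun k ↦ (bE k : ℂ), fun i k ↦ bE.repr ⟨x i, Submodule.subset_span (Set.mem_range_self i)⟩ k, ?_, ?_⟩
  · exact bE.linearIndependent.map' E.subtype (Submodule.ker_subtype E)
  · intro i
    have hxi : x i ∈ E := Submodule.subset_span (Set.mem_range_self i)
    have h := bE.sum_repr ⟨x i, hxi⟩
    have h' := congr_arg (fun z : E ↦ (z : ℂ)) h
    simp only [Submodule.coe_sum, Submodule.coe_smul_of_tower] at h'
    rw [← h']
    refine Finset.sum_congr rfl fun k _ ↦ ?_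
    rw [Rat.smul_def]

/-- With rational coordinates in an independent family, a rational linear form vanishes on `x` iff it vanishes coordinatewise. [folklore] -/
theorem sum_ratCast_mul_eq_zero_iff {ι : Type*} [Fintype ι] {n : ℕ} {e : Fin n → ℂ} {c : ι → Fin n → ℚ}
    (he : LinearIndependent ℚ e) {x : ι → ℂ} (hx : ∀ i, x i = ∑ k, (c i k : ℂ) * e k) (a : ι → ℚ) :
    ∑ i, (a i : ℂ) * x i = 0 ↔ ∀ k, ∑ i, a i * c i k = 0 := by
  have hsum : ∑ i, (a i : ℂ) * x i = ∑ k, ((∑ i, a i * c i k : ℚ) : ℂ) * e k := by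
    simp_rw [hx, Finset.mul_sum]
    rw [Finset.sum_comm]
    refine Finset.sum_congr rfl fun k _ ↦ ?_
    rw [Rat.cast_sum, Finset.sum_mul]
    refine Finset.sum_congr rfl fun i _ ↦ ?_
    push_cast
    ring
  rw [hsum]
  constructor
  · intro h k
    have h' : ∑ k, (∑ i, a i * c i k) • e k = 0 := by
      simpa only [Rat.smul_def] using h
    exact Fintype.linearIndependent_iff.mp he _ h' k
  · intro h
    simp [h]

/-- **Rational descent of linear relations.**  If a rational linear system `∀ s, Σᵢ a s i · xᵢ = 0` has a COMPLEX solution `x` on which a rational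
linear form `Σᵢ bᵢ xᵢ` does not vanish, it has a RATIONAL solution `y` with `Σᵢ bᵢ yᵢ ≠ 0`. [folklore] -/
theorem exists_rat_of_complex_solution {ι : Type*} [Fintype ι] {S : Type*} (a : S → ι → ℚ) (b : ι → ℚ) (x : ι → ℂ)
    (hx : ∀ s, ∑ i, (a s i : ℂ) * x i = 0) (hb : ∑ i, (b i : ℂ) * x i ≠ 0) :
    ∃ y : ι → ℚ, (∀ s, ∑ i, a s i * y i = 0) ∧ ∑ i, b i * y i ≠ 0 := by
  obtain ⟨n, e, c, he, hxe⟩ := exists_rat_coords x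
  -- the form `b` does not vanish on some coordinate column
  have hk : ∃ k, ∑ i, b i * c i k ≠ 0 := by
    by_contra hcon
    push Not at hcon
    exact hb ((sum_ratCast_mul_eq_zero_iff he hxe b).mpr hcon)
  obtain ⟨k, hk⟩ := hk
  exact ⟨fun i ↦ c i k, fun s ↦ (sum_ratCast_mul_eq_zero_iff he hxe (a s)).mp (hx s) k, hk⟩

/-- Variant with several non-vanishing forms tested at once: if SOME `b t` does not vanish on `x`, a rational solution exists on which some
`b t` does not vanish. [folklore] -/
theorem exists_rat_of_complex_solution' {ι : Type*} [Fintype ι] {S T : Type*} (a : S → ι → ℚ) (b : T → ι → ℚ) (x : ι → ℂ)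
    (hx : ∀ s, ∑ i, (a s i : ℂ) * x i = 0) (hb : ∃ t, ∑ i, (b t i : ℂ) * x i ≠ 0) :
    ∃ y : ι → ℚ, (∀ s, ∑ i, a s i * y i = 0) ∧ ∃ t, ∑ i, b t i * y i ≠ 0 := by
  obtain ⟨t, ht⟩ := hb
  obtain ⟨y, hy, hyt⟩ := exists_rat_of_complex_solution a (b t) x hx ht
  exact ⟨y, hy, t, hyt⟩

/-- Integer version (clear denominators): a rational linear system with a complex solution off a rational hyperplane has an INTEGER solution
off that hyperplane. [folklore] -/
theorem exists_int_of_complex_solution {ι : Type*} [Fintype ι] {S : Type*} (a : S → ι → ℚ) (b : ι → ℚ) (x : ι → ℂ)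
    (hx : ∀ s, ∑ i, (a s i : ℂ) * x i = 0) (hb : ∑ i, (b i : ℂ) * x i ≠ 0) :
    ∃ y : ι → ℤ, (∀ s, ∑ i, a s i * y i = 0) ∧ ∑ i, b i * y i ≠ 0 := by
  classical
  obtain ⟨y, hy, hyb⟩ := exists_rat_of_complex_solution a b x hx hb
  -- common denominator
  set d : ℕ := ∏ i, (y i).den with hd
  have hd0 : (d : ℚ) ≠ 0 := by
    rw [hd]; exact_mod_cast Finset.prod_ne_zero_iff.mpr fun i _ ↦ (y i).den_nz
  have hint : ∀ i, ∃ z : ℤ, (d : ℚ) * y i = z := fun i ↦ by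
    obtain ⟨r, hr⟩ : (y i).den ∣ d := Finset.dvd_prod_of_mem _ (Finset.mem_univ i)
    refine ⟨(r : ℤ) * (y i).num, ?_⟩
    rw [hr]
    push_cast
    rw [mul_comm ((y i).den : ℚ), mul_assoc, Rat.den_mul_eq_num]
  choose z hz using hint
  refine ⟨z, fun s ↦ ?_, ?_⟩
  · have : ∑ i, a s i * (z i : ℚ) = (d : ℚ) * ∑ i, a s i * y i := by
      rw [Finset.mul_sum]
      refine Finset.sum_congr rfl fun i _ ↦ ?_
      rw [← hz i]; ring
    rw [this, hy s, mul_zero]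
  · have : ∑ i, b i * (z i : ℚ) = (d : ℚ) * ∑ i, b i * y i := by
      rw [Finset.mul_sum]
      refine Finset.sum_congr rfl fun i _ ↦ ?_
      rw [← hz i]; ring
    rw [this]
    exact mul_ne_zero hd0 hyb

end Summit.BirchSwinnertonDyer.BirchSwinnertonDyer.Theorems.ManinLocalTwoThree.RationalDescent

end
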